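import Summits.ValiantsHypothesis.ValiantsHypothesis.Theorems.VPBoundarySquareBoundaryDichotomy
import Summits.ValiantsHypothesis.ValiantsHypothesis.Theorems.BarrierLeverNaturalProofsSeparateVNPBorder
import HarnessLib

/-!
# VP-boundary square — the case split of `S` on `U`, and the fork of the `M`-road

Route `VPBoundarySquare` decides `S := VP ℂ ≠ VNP ℂ` from
`Q := EmptyBoundarySeparates` («`VP` closed ⟹ `VNP ⊄ closure(VP)`», declared residual, road `M`)
and `P := CollapseEmptiesBoundary` («`VP = VNP` ⟹ `VP` closed», attacked piece, road `U`), with the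
banked asides `M := BoundaryOfVPNonempty` («`closure(VP) ∩ p-fam ⊄ VP`», the [GCT5] question of
Grochow–Mulmuley–Qiao 2016) and `U := ClosureDefinable` («`closure(VP) ∩ p-fam ⊆ VNP`», "not even
known", GMQ16 p. 3).  The route file's docstrings cite the node lemmas by name
(`node_iff`, `q_or_p`, `emptyBoundarySeparates_of_vh`, `collapseEmptiesBoundary_of_vh`,
`q_of_boundaryNonempty`, `p_of_closureDefinable`, `valiant_of_boundaryNonempty_of_closureDefinable`);
until now they lived only in the workshop draft.  This file lands them and adds the two
identities the workshop record uses (decomp-valiant lens 3, NODE §v17 / critic LESSON 2):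

* §1 **The node.** `node_iff : S ↔ Q ∧ P`; both pieces are consequences of `S`; `q_or_p`
  (mutual residuals: `(P → S) ↔ Q`, `(Q → S) ↔ P`); `Q ↔ S ∨ M`, `P ↔ (M → S)`.
* §2 **The lever.** `P ↔ S ∨ U` and `Q ↔ S ∨ ¬U`
  (`collapseEmptiesBoundary_iff_vh_or_closureDefinable`,
  `emptyBoundarySeparates_iff_vh_or_not_closureDefinable`): **the square is `S` by cases on `U`** —
  `valiant_iff_caseSplit : S ↔ (U → Q) ∧ (¬U → P)`; in `U`-worlds `P` holds and `Q ≡ S`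
  (`of_closureDefinable`), in `¬U`-worlds `Q` and `M` hold and `P ≡ S` (`of_not_closureDefinable`);
  `¬U` is exactly a boundary point of `VP` OUTSIDE `VNP`
  (`not_closureDefinable_iff_boundaryPointIn_not_vnp`).
* §3 **The fork of the `M`-road.** `boundaryOfVPNonempty_iff_fork : M ↔ M_VNP ∨ ¬U` with
  `M_VNP := BoundaryPointIn VNP` («a `VNP` family in `closure(VP) ∖ VP`»), and `M_VNP ⟹ S` outright
  (the landed `valiant_of_vnpBoundaryPoint`); hence `M → S ∨ ¬U`, and short of `S` the whole square
  has ONE unknown bit: `of_not_vh : ¬S → (P ↔ U) ∧ (Q ↔ ¬U) ∧ (M ↔ ¬U)`.  In words: an `M`-witness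
  is either already a proof of `VP ≠ VNP` (witnessed on the boundary) or an explicit p-family of
  p-bounded border complexity outside `VNP` — the `M`-road has no content short of `S` other than `¬U`.
* §4 **Equational silence on both prongs.** `not_isVPBarFamily_of_equations`: if for every size
  exponent `b`, infinitely often, some polynomial equation of the coefficient vectors of
  `SmallCircuits ℂ n b` (degree `≤ n`, size `≤ n^b`) is nonzero at `h_n`, then `h ∉ closure(VP)` —
  the distinguisher-free form of the landed `Border.not_isVPBarFamily_of_naturalProofAgainstVP`
  (Forbes–Shpilka–Volk: algebraically natural proofs are border lower bounds).  So neither prong of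
  the `M`-road admits an equational certificate of its exact lower bound: not `h ∉ VP` for an
  `M`-witness (`no_equations_of_isVPBarFamily`, `no_naturalProofAgainstVP_of_isVPBarFamily`), and not
  `h ∉ VNP` for a `¬U`-witness either, since equations of any class containing the small circuits are
  in particular equations of the small circuits (`no_equations_of_boundaryWitness`).  The finite-level
  instances of exact-versus-border gaps in the tree are accordingly certified by NON-closed conditions:
  `\overline{dc}(P_{Λ,n}) = n < n + 1 ≤ dc(P_{Λ,n})` and `dc(P_{Λ,3}) ≥ 5`
  (`Literature/…/LMR13DualVarieties`, `…/LMR13BoundaryFormDcThree`: conciseness + stabiliser /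
  boundary-component structure, Landsberg 2017 §6.7), border Waring rank `2 <` Waring rank `d` of
  `x^{d-1}y` (`…/BDI20WaringBorderWaringGap`), Kumar's `Σ^[2]ΠΣ` closure
  (`Theorems/ChowBorderDepth3ChowBorderBoundNegativeDBound`).

Honest framing: nothing here proves `S`, `Q`, `P`, `M`, `U` or their negations; every statement is
propositional glue over the tree's classes plus one Zariski-closure estimate already in the tree.
LADDER-Valiant rung 0; the route's statements, split and `closes` are unchanged.

References: Grochow–Mulmuley–Qiao 2016, §1 (the questions `closure(VP) = VP?`, `closure(VP) ⊆ VNP?`;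
`GrochowMulmuleyQiao2016`); Bürgisser–Landsberg–Manivel–Weyman 2011, Def. 9.3.1, §9.3
(`BurgisserEtAl2011`); Forbes–Shpilka–Volk 2018, Def. 1, §1.1 (`ForbesShpilkaVolk2018`);
Bürgisser 2000, Def. 2.1–2.5 (`Burgisser2000`); Landsberg 2017, §6.7.1–6.7.3 (`Landsberg2017`).
-/

noncomputable section

set_option linter.dupNamespace false

open MvPolynomial
open Literature.Computability.AlgebraicComplexity Literature.Computability.Complexity
open Literature.Barriers.ValiantsHypothesis
open Summit.ValiantsHypothesis.ValiantsHypothesis.Theses.VPBoundarySquare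
open Summit.ValiantsHypothesis.ValiantsHypothesis.Theorems.VPBoundarySquareBoundaryDichotomy
open Summit.ValiantsHypothesis.ValiantsHypothesis.Theorems.BarrierLever.NaturalProofsSeparateVNP

namespace Summit.ValiantsHypothesis.ValiantsHypothesis.Theorems.VPBoundarySquareCaseSplit

/-! ### §1 The node: necessity of both pieces, exactness, mutual residuals -/

/-- `¬M` is «`VP` is closed»: every p-family of p-bounded border complexity is p-computable
(the hypothesis of `Q`, the conclusion of `P`). [cite: BurgisserEtAl2011, §9.3 (closure of VP)] -/
theorem not_boundaryOfVPNonempty_iff :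
    ¬ BoundaryOfVPNonempty ↔ ∀ (v : ℕ → ℕ) (f : ∀ n, MvPolynomial (Fin (v n)) ℂ),
      IsPFamily f → IsVPBarFamily f → IsPComputable f := by
  rw [BoundaryOfVPNonempty, not_not]

/-- Under the collapse `VP = VNP`, `VNP = VP ⊆ closure(VP)` on p-families (`\underline{L} ≤ L`).
[cite: BurgisserEtAl2011, §9.3 (closure of VP)] -/
theorem vnpSubsetVPBar_of_collapse (hEq : VP ℂ = VNP ℂ) : VNPSubsetVPBar := by
  intro v f hf
  have hVP : (⟨v, f⟩ : PolyFamily ℂ) ∈ VP ℂ := by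
    rw [hEq]; exact hf
  exact hVP.2.mono fun n => approxComplexity_le_complexity (f n)

/-- **NEC(Q): `S ⟹ Q`** (a `VNP` family that is not p-computable cannot lie in a closed `VP`
containing `VNP`). [cite: BurgisserClausenShokrollahi1997, §21.5 p. 561] -/
theorem emptyBoundarySeparates_of_vh (hS : ValiantsHypothesis) : EmptyBoundarySeparates :=
  emptyBoundarySeparates_iff_on_univ.2
    (emptyBoundarySeparatesOn_of_valiant (D := fun _ _ => True) (fun _ _ _ => trivial) hS)

/-- **NEC(P): `S ⟹ P`** (the hypothesis of `P` is `¬S`). [folklore] -/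
theorem collapseEmptiesBoundary_of_vh (hS : ValiantsHypothesis) : CollapseEmptiesBoundary :=
  fun hEq => absurd hEq hS

/-- **NODE IDENTITY `S ⟺ Q ∧ P`** (the converse is the route's certified `closes`). [folklore] -/
theorem node_iff : ValiantsHypothesis ↔ EmptyBoundarySeparates ∧ CollapseEmptiesBoundary :=
  ⟨fun hS => ⟨emptyBoundarySeparates_of_vh hS, collapseEmptiesBoundary_of_vh hS⟩,
    fun h => closes h.1 h.2⟩

/-- Road `M ⟹ Q` (trivially: the hypothesis of `Q` is `¬M`). [cite: GrochowMulmuleyQiao2016, §1] -/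
theorem q_of_boundaryNonempty (hM : BoundaryOfVPNonempty) : EmptyBoundarySeparates :=
  fun hD => absurd hD hM

/-- Road `¬M ⟹ P` (`VP` closed outright). [folklore] -/
theorem p_of_not_boundaryNonempty (hM : ¬ BoundaryOfVPNonempty) : CollapseEmptiesBoundary :=
  fun _ => not_boundaryOfVPNonempty_iff.1 hM

/-- **Mutual residuals: `Q ∨ P` is a theorem** (by cases on `M`). [folklore] -/
theorem q_or_p : EmptyBoundarySeparates ∨ CollapseEmptiesBoundary := by
  by_cases hM : BoundaryOfVPNonempty
  · exact Or.inl (q_of_boundaryNonempty hM)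
  · exact Or.inr (p_of_not_boundaryNonempty hM)

/-- `(P → S) ↔ Q`: `Q` is exactly the residual of `P`. [folklore] -/
theorem residual_of_P_iff :
    (CollapseEmptiesBoundary → ValiantsHypothesis) ↔ EmptyBoundarySeparates := by
  refine ⟨fun h hD hN => ?_, fun hQ hP => closes hQ hP⟩
  exact emptyBoundarySeparates_of_vh (h fun _ => hD) hD hN

/-- `(Q → S) ↔ P`: `P` is exactly the residual of `Q`. [folklore] -/
theorem residual_of_Q_iff :
    (EmptyBoundarySeparates → ValiantsHypothesis) ↔ CollapseEmptiesBoundary := by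
  refine ⟨fun h hEq => ?_, fun hP hQ => closes hQ hP⟩
  by_contra hnD
  have hM : BoundaryOfVPNonempty := fun hD => hnD hD
  exact h (q_of_boundaryNonempty hM) hEq

/-- **`Q ⟺ S ∨ M`** (critic LESSON 2). [cite: GrochowMulmuleyQiao2016, §1] -/
theorem emptyBoundarySeparates_iff_vh_or_boundary :
    EmptyBoundarySeparates ↔ ValiantsHypothesis ∨ BoundaryOfVPNonempty := by
  constructor
  · intro hQ
    by_cases hM : BoundaryOfVPNonempty
    · exact Or.inr hM
    · exact Or.inl (valiant_of_not_vnpSubsetVPBar (hQ (not_boundaryOfVPNonempty_iff.1 hM)))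
  · rintro (hS | hM)
    · exact emptyBoundarySeparates_of_vh hS
    · exact q_of_boundaryNonempty hM

/-- **`P ⟺ (M → S)`** (critic LESSON 2). [cite: GrochowMulmuleyQiao2016, §1] -/
theorem collapseEmptiesBoundary_iff_boundary_imp_vh :
    CollapseEmptiesBoundary ↔ (BoundaryOfVPNonempty → ValiantsHypothesis) := by
  constructor
  · intro hP hM hEq
    exact hM (hP hEq)
  · intro h hEq
    by_contra hnD
    exact h (fun hD => hnD hD) hEq

/-! ### §2 The lever `U = ClosureDefinable`: the square is `S` by cases on `U` -/

/-- Road `U ⟹ P`: if `closure(VP) ∩ p-fam ⊆ VNP` then under the collapse it is `⊆ VNP = VP`.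
[cite: GrochowMulmuleyQiao2016, §1 (p. 3)] -/
theorem p_of_closureDefinable (hU : ClosureDefinable) : CollapseEmptiesBoundary := by
  intro hEq v f hpf hbar
  have hVP : (⟨v, f⟩ : PolyFamily ℂ) ∈ VP ℂ := by
    rw [hEq]; exact hU v f hpf hbar
  exact hVP.2

/-- **SUFFICIENT SANDWICH `M → U → S`.** [cite: GrochowMulmuleyQiao2016, §1 (p. 3)] -/
theorem valiant_of_boundaryNonempty_of_closureDefinable (hM : BoundaryOfVPNonempty)
    (hU : ClosureDefinable) : ValiantsHypothesis :=
  closes (q_of_boundaryNonempty hM) (p_of_closureDefinable hU)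

/-- In a `¬S`-world `P` forces `U`: `closure(VP) ∩ p-fam ⊆ VP ⊆ VNP`. [cite: Burgisser2000, §2.1] -/
theorem closureDefinable_of_p_of_not_vh (hP : CollapseEmptiesBoundary) (hS : ¬ ValiantsHypothesis) :
    ClosureDefinable := by
  have hEq : VP ℂ = VNP ℂ := by
    by_contra h
    exact hS h
  intro v f hpf hbar
  exact IsVPFamily.isVNPFamily_holds' ⟨hpf, hP hEq v f hpf hbar⟩

/-- **`P ⟺ S ∨ U`**: the attacked piece's entire content short of `S` is the lever `U`.
[cite: GrochowMulmuleyQiao2016, §1 (p. 3)] -/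
theorem collapseEmptiesBoundary_iff_vh_or_closureDefinable :
    CollapseEmptiesBoundary ↔ ValiantsHypothesis ∨ ClosureDefinable := by
  constructor
  · intro hP
    by_cases hS : ValiantsHypothesis
    · exact Or.inl hS
    · exact Or.inr (closureDefinable_of_p_of_not_vh hP hS)
  · rintro (hS | hU)
    · exact collapseEmptiesBoundary_of_vh hS
    · exact p_of_closureDefinable hU

/-- **`¬U` is exactly a boundary point of `VP` outside `VNP`** (a p-family of p-bounded border
complexity that is not in `VNP` is automatically not p-computable, `VP ⊆ VNP`).
[cite: Burgisser2000, §2.1] -/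
theorem not_closureDefinable_iff_boundaryPointIn_not_vnp :
    ¬ ClosureDefinable ↔ BoundaryPointIn fun _ f => ¬ IsVNPFamily f := by
  constructor
  · intro hU
    by_contra hno
    refine hU fun v f hpf hbar => ?_
    by_contra hvnp
    exact hno ⟨v, f, hpf, hvnp, hbar,
      fun hcomp => hvnp (IsVPFamily.isVNPFamily_holds' ⟨hpf, hcomp⟩)⟩
  · rintro ⟨v, f, hpf, hvnp, hbar, -⟩ hU
    exact hvnp (hU v f hpf hbar)

/-- `¬U ⟹ M`. [cite: GrochowMulmuleyQiao2016, §1] -/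
theorem boundaryOfVPNonempty_of_not_closureDefinable (hU : ¬ ClosureDefinable) :
    BoundaryOfVPNonempty :=
  boundaryOfVPNonempty_iff_on_univ.2
    (boundaryPointIn_mono (D' := fun _ _ => True) (fun _ _ _ => trivial)
      (not_closureDefinable_iff_boundaryPointIn_not_vnp.1 hU))

/-- `¬U ⟹ Q`. [cite: GrochowMulmuleyQiao2016, §1] -/
theorem q_of_not_closureDefinable (hU : ¬ ClosureDefinable) : EmptyBoundarySeparates :=
  q_of_boundaryNonempty (boundaryOfVPNonempty_of_not_closureDefinable hU)

/-- **`Q ⟺ S ∨ ¬U`**: the residual's entire content short of `S` is `¬U`.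
[cite: GrochowMulmuleyQiao2016, §1 (p. 3)] -/
theorem emptyBoundarySeparates_iff_vh_or_not_closureDefinable :
    EmptyBoundarySeparates ↔ ValiantsHypothesis ∨ ¬ ClosureDefinable := by
  constructor
  · intro hQ
    by_cases hU : ClosureDefinable
    · exact Or.inl (closes hQ (p_of_closureDefinable hU))
    · exact Or.inr hU
  · rintro (hS | hU)
    · exact emptyBoundarySeparates_of_vh hS
    · exact q_of_not_closureDefinable hU

/-- **THE CASE SPLIT: `S ⟺ (U → Q) ∧ (¬U → P)`** — Valiant's hypothesis is exactly «in the
`U`-world the empty-boundary hypothesis separates, and in the `¬U`-world the collapse empties the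
boundary». [cite: GrochowMulmuleyQiao2016, §1 (p. 3)] -/
theorem valiant_iff_caseSplit :
    ValiantsHypothesis ↔
      (ClosureDefinable → EmptyBoundarySeparates) ∧ (¬ ClosureDefinable → CollapseEmptiesBoundary) := by
  constructor
  · exact fun hS => ⟨fun _ => emptyBoundarySeparates_of_vh hS, fun _ => collapseEmptiesBoundary_of_vh hS⟩
  · rintro ⟨hUQ, hnUP⟩
    by_cases hU : ClosureDefinable
    · exact closes (hUQ hU) (p_of_closureDefinable hU)
    · exact closes (q_of_not_closureDefinable hU) (hnUP hU)

/-- `U`-worlds: `P` holds and `Q ≡ S`. [cite: GrochowMulmuleyQiao2016, §1 (p. 3)] -/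
theorem of_closureDefinable (hU : ClosureDefinable) :
    CollapseEmptiesBoundary ∧ (EmptyBoundarySeparates ↔ ValiantsHypothesis) :=
  ⟨p_of_closureDefinable hU,
    fun hQ => closes hQ (p_of_closureDefinable hU), emptyBoundarySeparates_of_vh⟩

/-- `¬U`-worlds: `Q` and `M` hold and `P ≡ S`. [cite: GrochowMulmuleyQiao2016, §1 (p. 3)] -/
theorem of_not_closureDefinable (hU : ¬ ClosureDefinable) :
    EmptyBoundarySeparates ∧ BoundaryOfVPNonempty ∧ (CollapseEmptiesBoundary ↔ ValiantsHypothesis) :=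
  ⟨q_of_not_closureDefinable hU, boundaryOfVPNonempty_of_not_closureDefinable hU,
    fun hP => closes (q_of_not_closureDefinable hU) hP, collapseEmptiesBoundary_of_vh⟩

/-! ### §3 The fork of the `M`-road -/

/-- **`M ⟺ M_VNP ∨ ¬U`**: a boundary point of `VP` lies in `VNP` — and then it IS a proof of
`VP ≠ VNP` (`valiant_of_vnpBoundaryPoint`) — or outside `VNP`, and then it IS `¬U`.
[cite: GrochowMulmuleyQiao2016, §1] -/
theorem boundaryOfVPNonempty_iff_fork :
    BoundaryOfVPNonempty ↔
      (BoundaryPointIn fun _ f => IsVNPFamily f) ∨ ¬ ClosureDefinable := by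
  rw [not_closureDefinable_iff_boundaryPointIn_not_vnp, boundaryOfVPNonempty_iff_on_univ]
  constructor
  · rintro ⟨v, f, hpf, -, hbar, hnc⟩
    by_cases hvnp : IsVNPFamily f
    · exact Or.inl ⟨v, f, hpf, hvnp, hbar, hnc⟩
    · exact Or.inr ⟨v, f, hpf, hvnp, hbar, hnc⟩
  · rintro (h | h)
    · exact boundaryPointIn_mono (fun _ _ _ => trivial) h
    · exact boundaryPointIn_mono (fun _ _ _ => trivial) h

/-- **`M ⟹ S ∨ ¬U`**: the `M`-road has no content short of `S` other than `¬U`.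
[cite: GrochowMulmuleyQiao2016, §1] -/
theorem vh_or_not_closureDefinable_of_boundaryNonempty (hM : BoundaryOfVPNonempty) :
    ValiantsHypothesis ∨ ¬ ClosureDefinable :=
  (boundaryOfVPNonempty_iff_fork.1 hM).imp_left valiant_of_vnpBoundaryPoint

/-- `M ∧ U ⟹ M_VNP`: under the lever every boundary point is a `VNP` boundary point (and proves
`S`, `valiant_of_boundaryNonempty_of_closureDefinable`). [cite: GrochowMulmuleyQiao2016, §1] -/
theorem vnpBoundaryPoint_of_boundaryNonempty_of_closureDefinable (hM : BoundaryOfVPNonempty)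
    (hU : ClosureDefinable) : BoundaryPointIn fun _ f => IsVNPFamily f :=
  (boundaryOfVPNonempty_iff_fork.1 hM).resolve_right fun h => h hU

/-- **Short of `S` the square has ONE unknown bit**: in a `¬S`-world `P ≡ U`, `Q ≡ ¬U` and
`M ≡ ¬U` (so `Q ≡ M`: the residual and its road coincide there). [cite: GrochowMulmuleyQiao2016, §1 (p. 3)] -/
theorem of_not_vh (hS : ¬ ValiantsHypothesis) :
    (CollapseEmptiesBoundary ↔ ClosureDefinable) ∧ (EmptyBoundarySeparates ↔ ¬ ClosureDefinable) ∧
      (BoundaryOfVPNonempty ↔ ¬ ClosureDefinable) := by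
  refine ⟨⟨fun hP => closureDefinable_of_p_of_not_vh hP hS, p_of_closureDefinable⟩,
    ⟨fun hQ => ?_, q_of_not_closureDefinable⟩, ⟨fun hM => ?_, boundaryOfVPNonempty_of_not_closureDefinable⟩⟩
  · exact (emptyBoundarySeparates_iff_vh_or_not_closureDefinable.1 hQ).resolve_left hS
  · exact (vh_or_not_closureDefinable_of_boundaryNonempty hM).resolve_left hS

/-- The total collapse `VP = VNP = closure(VP) ∩ p-fam` is exactly `¬S ∧ U` (equivalently `¬Q`);
the world `VP = VNP ⊊ closure(VP) ∩ p-fam` is exactly `¬S ∧ ¬U` (equivalently `¬P`).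
[cite: GrochowMulmuleyQiao2016, §1 (p. 3)] -/
theorem not_q_iff_and_not_p_iff :
    (¬ EmptyBoundarySeparates ↔ ¬ ValiantsHypothesis ∧ ClosureDefinable) ∧
      (¬ CollapseEmptiesBoundary ↔ ¬ ValiantsHypothesis ∧ ¬ ClosureDefinable) := by
  rw [emptyBoundarySeparates_iff_vh_or_not_closureDefinable,
    collapseEmptiesBoundary_iff_vh_or_closureDefinable]
  tauto

/-! ### §4 Equational silence on both prongs of the `M`-road -/

/-- **Equations of the small-circuit varieties prove BORDER lower bounds only.** If for every size
exponent `b`, for infinitely many `n`, some polynomial `D` in the coefficients of the monomials of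
degree `≤ n` vanishes on (the coefficient vectors of) `SmallCircuits ℂ n b` and not at `h_n`, then
`\underline{L}(h_n)` is not p-bounded, i.e. `h ∉ closure(VP)` — whatever else `D` vanishes on and
however `D` was found (the distinguisher-free form of `Border.not_isVPBarFamily_of_naturalProofAgainstVP`).
[cite: ForbesShpilkaVolk2018, §1.1] [cite: BurgisserEtAl2011, §9.3] -/
theorem not_isVPBarFamily_of_equations {h : ∀ n, MvPolynomial (Fin n) ℂ}
    (heq : ∀ b n₀ : ℕ, ∃ n, n₀ ≤ n ∧ ∃ D : MvPolynomial (degLEMonomials n) ℂ,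
      (∀ f ∈ SmallCircuits ℂ n b, eval (coeffVector (degLEMonomials n) f) D = 0) ∧
        eval (coeffVector (degLEMonomials n) (h n)) D ≠ 0) :
    ¬ IsVPBarFamily h := by
  intro hbar
  obtain ⟨A, B, hAB⟩ := (IsPBounded.iff_exists_le_mul_succ_pow _).1 hbar
  obtain ⟨n₀, hn₀⟩ := Border.truncation_budget A B
  obtain ⟨n, hn, D, hvan, hne⟩ := heq (B + 3) n₀
  exact absurd (hAB n) (not_le.mpr (Border.lt_approxComplexity hvan hne (hn₀ n hn)))

/-- Hence a family IN `closure(VP)` (indexed by its number of variables) admits NO such system of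
equations: at all large levels every equation of `SmallCircuits ℂ n b` (for a suitable `b`) vanishes
at `h_n`. [cite: ForbesShpilkaVolk2018, §1.1] [cite: BurgisserEtAl2011, §9.3] -/
theorem no_equations_of_isVPBarFamily {h : ∀ n, MvPolynomial (Fin n) ℂ} (hbar : IsVPBarFamily h) :
    ∃ b n₀ : ℕ, ∀ n, n₀ ≤ n → ∀ D : MvPolynomial (degLEMonomials n) ℂ,
      (∀ f ∈ SmallCircuits ℂ n b, eval (coeffVector (degLEMonomials n) f) D = 0) →
        eval (coeffVector (degLEMonomials n) (h n)) D = 0 := by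
  by_contra hno
  push Not at hno
  refine not_isVPBarFamily_of_equations (fun b n₀ => ?_) hbar
  obtain ⟨n, hn, D, hvan, hne⟩ := hno b n₀
  exact ⟨n, hn, D, hvan, hne⟩

/-- In particular an algebraically natural proof against `VP` in the sense of Forbes–Shpilka–Volk
(any constructivity level) is unavailable for a family in `closure(VP)`.
[cite: ForbesShpilkaVolk2018, Def. 1 and §1.1] -/
theorem no_naturalProofAgainstVP_of_isVPBarFamily {h : ∀ n, MvPolynomial (Fin n) ℂ}
    (hbar : IsVPBarFamily h) (a : ℕ) : ¬ NaturalProofAgainstVP ℂ a h :=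
  fun hnat => Border.not_isVPBarFamily_of_naturalProofAgainstVP hnat hbar

/-- **Both prongs of the `M`-road are invisible to equations.** A boundary witness `h` (a p-family in
`closure(VP)`, with `v = id`) — whether an `M_VNP`-witness (to be shown: `h ∉ VP`) or a `¬U`-witness
(to be shown: `h ∉ VNP`) — satisfies, at all large levels, every equation of `SmallCircuits ℂ n b`;
so no polynomial vanishing on a class CONTAINING the small circuits (all of `VP`-size-`n^b`, or the
`VNP`-succinct polynomials, or anything larger) can be nonzero at `h_n`: the exact lower bound must
be certified by a condition that is not Zariski-closed-avoiding, as in the tree's finite-level gaps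
(`LMR13BoundaryFormDcThree`, `BDI20WaringBorderWaringGap`). [cite: ForbesShpilkaVolk2018, §1.1]
[cite: Landsberg2017, §6.7.1–6.7.2] -/
theorem no_equations_of_boundaryWitness {h : ∀ n, MvPolynomial (Fin n) ℂ} (hbar : IsVPBarFamily h)
    (C : ∀ n, Set (MvPolynomial (Fin n) ℂ)) :
    ∃ b n₀ : ℕ, ∀ n, n₀ ≤ n → SmallCircuits ℂ n b ⊆ C n → ∀ D : MvPolynomial (degLEMonomials n) ℂ,
      (∀ f ∈ C n, eval (coeffVector (degLEMonomials n) f) D = 0) →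
        eval (coeffVector (degLEMonomials n) (h n)) D = 0 := by
  obtain ⟨b, n₀, H⟩ := no_equations_of_isVPBarFamily hbar
  exact ⟨b, n₀, fun n hn hC D hvan => H n hn D fun f hf => hvan f (hC hf)⟩

end Summit.ValiantsHypothesis.ValiantsHypothesis.Theorems.VPBoundarySquareCaseSplit
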